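import Mathlib
import Summits.NavierStokesRegularity.NavierStokesRegularity.Theorems.L3TimeExponentPincerPaceDichotomy
import Summits.NavierStokesRegularity.NavierStokesRegularity.Theorems.L3TimeExponentPincerJawEnergyFloor
import Summits.NavierStokesRegularity.NavierStokesRegularity.Theorems.L3TimeExponentPincerEffSatBlowupStubParabolicConcentrationBlowup
import Summits.NavierStokesRegularity.NavierStokesRegularity.Theorems.L3TimeExponentPincerSmoothBranch
import Summits.NavierStokesRegularity.NavierStokesRegularity.Theorems.L3TimeExponentPincerMorreyGrowth
import Literature.Analysis.FunctionSpaces.MazyaTraceInequality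
import HarnessLib.Audit
import HarnessLib

/-!
# The parent crux `L3CascadeJaw` on the full-Morrey-Type-I class: `u ∈ L⁶_t L³_x` from Maz'ya's
# trace inequality (route `L3TimeExponentPincer`, item `stmt-NavierStokesRegularity-19499`)

Support file (cell ns-regularity-ideate, seat p2, ROUND-9).  `L3CascadeJaw` asks, for every frame solution
(classical on `[0,T)` + Leray–Hopf + decaying data), `∫_{T₂}^{T} ‖u(t)‖₃^q dt < ∞` for every `q ∈ (4,5)`.
The energy class gives `q ≤ 4` (`L3TimeExponentPincerJawEnergyFloor`).  This file decides the clause — up to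
the endpoint `q = 6` — on the class of solutions that are **full Morrey-Type-I near `T`**
(`FullMorreyTypeINear`: `∫_{B(x₀,r)} |u(t)|² ≤ M r` for all late `t`, all `x₀`, all `r < r₁`; i.e. the
CKN/Seregin scaled energy `A(z₀; r)` bounded over ALL late parabolic cylinders), modulo ONE classical
real-analysis fact used as a hypothesis:

* `MazyaTraceD` — Maz'ya's trace inequality, `𝒟((EuclideanSpace ℝ (Fin 3)))` form, `q = 1`, `n = 3`, for `μ = g dx`:
  `∫ g|w| ≤ c · K · ∫|∇w|` whenever `∫_{B(x,r)} g ≤ K r²` for all balls [Mazja1985, §1.4.2 Theorem 2 with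
  Theorem 1 (2)]; = Meyers–Ziemer (1977) for `BV`.

`MazyaTraceD`, `BallGrowthTwo` and the PROVED density step to smooth integrable `w`
(`mazyaTrace_integrable_of_D`) live in `Literature/Analysis/FunctionSpaces/MazyaTraceInequality.lean`; the ball
growth `∫_{B(x,r)}|f| ≤ K r²` for ALL `r` from Morrey (`r < r₁`) + energy (`r ≥ r₁`) + Cauchy–Schwarz
(`K = |B₁|^{1/2}(M^{1/2} + (e₀/r₁)^{1/2})`) and `‖∇|f|²‖₁ ≤ 2‖f‖₂‖∇f‖₂` live in the helper
`L3TimeExponentPincerMorreyGrowth`.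

PROVED here (0 `sorry`):
* the slice inequality `∫|f|³ = ∫|f|·|f|² ≤ c K · 2 e₀^{1/2} (∫|∇f|²)^{1/2}` and THEOREM J′:
  `MazyaTraceW11 →` on the full-Morrey class `(∫|u(t)|³)² ≤ A ∫|∇u(t)|²` for all late `t`, hence
  `∫_{T₂}^{T}‖u‖₃⁶ < ∞` (`lintegral_six_lt_top`) and `∫_{T₂}^{T}‖u‖₃^q < ∞` for EVERY `0 ≤ q ≤ 6`
  (`jawUpToSix_of`, `jawUpToSix_of_mazya`), in particular the clause of `L3CascadeJaw` on the class
  (`l3CascadeJaw_clause_on_fullMorrey`);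
* hierarchy: time-Type-I (`IsTypeIBlowup`) ⇒ full Morrey (`fullMorreyTypeINear_of_typeI`, through the
  certificate-ladder theorem `scaledEnergyBound_proof`) ⇒ Morrey on cylinders reaching `T`
  (`morreyTypeINear_of_full`, the `MorreyTypeINear` of `L3TimeExponentPincerPaceDichotomy`);
* BY NAME: `@[conjecture] AllBlowupsFullMorreyB` (every frame blow-up is full-Morrey-Type-I; implied by the
  hard core `NoTypeII`, `allBlowupsFullMorreyB_of_noTypeII`) and `MazyaTraceD → AllBlowupsFullMorreyB → L3CascadeJaw`
  (`l3CascadeJaw_of_allBlowupsFullMorrey`, smooth branch = `jawSmoothBranch_holds`);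
* the UNCONDITIONAL elementary companion (time-Type-I ⇒ every `q < 6` by `‖u‖₃³ ≤ ‖u‖_∞‖u‖₂²`, and
  `NoTypeII → L3CascadeJaw` stub-free) is the helper `L3TimeExponentPincerJawTypeIElementary`.

So the content of J′ is the extension from the time-Type-I to the full-Morrey (= Type-II-RATE-allowed,
scaled-energy-Type-I) class and the endpoint `q = 6`; what remains open of `L3CascadeJaw` is exactly the class of
blow-ups with UNBOUNDED scaled energy on some late cylinders ("Morrey-Type-II").  Nearest print: Seregin,
*Estimates of suitable weak solutions … in critical Morrey spaces*, J. Math. Sci. 143 (2007) = arXiv:math/0607534,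
Lemma 1.8 (`sup_r A < ∞ ⇒ C^{4/3} + D₀ + E` bounded — local, scale-invariant; no global time exponent); Barker,
arXiv:2111.14776 (higher `L^{4+δ}_t L³` integrability under `L^∞_t L^{3,∞}_x`).
References: V. G. Maz'ya, *Sobolev Spaces*, Springer 1985, §1.4.2 [Mazja1985]; N. G. Meyers, W. P. Ziemer,
Amer. J. Math. 99 (1977) 1345–1360.
-/

noncomputable section

namespace Summit.NavierStokesRegularity.NavierStokesRegularity.Theorems.L3TimeExponentPincerJawFullMorrey

open MeasureTheory Set Function Filter Metric Topology
open scoped ENNReal NNReal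
open Literature.Analysis.FluidPDE
open Summit.NavierStokesRegularity.NavierStokesRegularity.Theorems.L3TimeExponentPincerPaceDichotomy
  (MorreyTypeINear)
open Summit.NavierStokesRegularity.NavierStokesRegularity.Theorems
  (scaledEnergyBound_proof typeIConc_lintegral_ball_enorm_pow_eq)


open Summit.NavierStokesRegularity.NavierStokesRegularity.Theorems.L3TimeExponentPincerMorreyGrowth
open Literature.Analysis.FunctionSpaces (BallGrowthTwo MazyaTraceD mazyaTrace_integrable_of_D)

/-! ### Objects -/

/-- dissipation rate `δ(τ) = ∫ |∇u(τ)|²` (Frobenius norm of the classical gradient). -/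
def dissipRate (u : ℝ → (EuclideanSpace ℝ (Fin 3)) → (EuclideanSpace ℝ (Fin 3))) (τ : ℝ) : ℝ≥0∞ :=
  ∫⁻ x, ENNReal.ofReal (frobeniusNormSq (fderiv ℝ (u τ) x))

/-- **FULL Morrey-Type-I bound near `T`**: `∫_{B(x₀,r)} |u(t)|² ≤ M r` for ALL late times
`t ∈ (T₁, T)`, all centres and all radii `0 < r < r₁`. -/
def FullMorreyTypeINear (u : ℝ → (EuclideanSpace ℝ (Fin 3)) → (EuclideanSpace ℝ (Fin 3))) (T : ℝ) : Prop :=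
  ∃ M : ℝ, 0 < M ∧ ∃ r₁ : ℝ, 0 < r₁ ∧ ∃ T₁ < T, ∀ t ∈ Ioo T₁ T, ∀ x₀ : (EuclideanSpace ℝ (Fin 3)), ∀ r : ℝ, 0 < r → r < r₁ →
    ∫⁻ x in ball x₀ r, ‖u t x‖ₑ ^ 2 ≤ ENNReal.ofReal (M * r)


/-- Maz'ya's trace inequality for smooth INTEGRABLE `w` (the form used on velocity slices); it follows from the
literature fact `MazyaTraceD` by `Literature.Analysis.FunctionSpaces.mazyaTrace_integrable_of_D`. -/
def MazyaTraceW11 : Prop :=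
  ∃ c : ℝ≥0, ∀ (g : (EuclideanSpace ℝ (Fin 3)) → ℝ≥0∞), Measurable g → ∀ K : ℝ≥0, BallGrowthTwo g K →
    ∀ (w : (EuclideanSpace ℝ (Fin 3)) → ℝ), ContDiff ℝ (⊤ : ℕ∞) w → Integrable w volume →
      ∫⁻ x, g x * ‖w x‖ₑ ≤ (c : ℝ≥0∞) * K * ∫⁻ x, ‖fderiv ℝ w x‖ₑ

/-- The density step, by name. -/
theorem mazyaTraceW11_of_D (h : MazyaTraceD) : MazyaTraceW11 := mazyaTrace_integrable_of_D h

/-- The conclusion of J′: on the full-Morrey class, `∫_{T₂}^{T} ‖u(t)‖₃^q dt < ∞` for all `0 ≤ q ≤ 6`. -/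
def JawUpToSixOnFullMorrey : Prop :=
  ∀ (ν T : ℝ), 0 < ν → 0 < T → ∀ (u : ℝ → (EuclideanSpace ℝ (Fin 3)) → (EuclideanSpace ℝ (Fin 3))) (p : ℝ → (EuclideanSpace ℝ (Fin 3)) → ℝ),
    IsClassicalNSSolutionOn (Ico 0 T) ν 0 u p → IsLerayHopfOn T ν 0 (u 0) u →
    FullMorreyTypeINear u T → ∀ q : ℝ, 0 ≤ q → q ≤ 6 →
      ∃ T₂ ∈ Ioo 0 T, (∫⁻ t in Ioo T₂ T, eLpNorm (u t) 3 volume ^ q) < ⊤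

/-! ### The slice inequality `‖f‖₃³ ≤ 2 c K √e₀ ‖∇f‖₂` -/

/-- The slice inequality `∫|f|³ ≤ c K · 2 e₀^{1/2} ‖∇f‖₂` from the `W^{1,1}` trace inequality, the ball growth of `|f| dx` and `‖∇|f|²‖₁ ≤ 2‖f‖₂‖∇f‖₂`. -/
theorem lintegral_cube_le (hMZ : MazyaTraceW11) :
    ∃ c : ℝ≥0, ∀ (f : (EuclideanSpace ℝ (Fin 3)) → (EuclideanSpace ℝ (Fin 3))), ContDiff ℝ (⊤ : ℕ∞) f → ∀ (M e₀ r₁ : ℝ), 0 < M → 0 ≤ e₀ → 0 < r₁ →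
      ∫⁻ y, ‖f y‖ₑ ^ 2 ≤ ENNReal.ofReal e₀ →
      (∀ x₀ : (EuclideanSpace ℝ (Fin 3)), ∀ r : ℝ, 0 < r → r < r₁ → ∫⁻ y in ball x₀ r, ‖f y‖ₑ ^ 2 ≤ ENNReal.ofReal (M * r)) →
      ∫⁻ y, ‖f y‖ₑ ^ (3 : ℕ) ≤ (c : ℝ≥0∞) * growthConst M e₀ r₁ *
        (2 * (ENNReal.ofReal e₀) ^ (1 / 2 : ℝ) *
          (∫⁻ x, ENNReal.ofReal (frobeniusNormSq (fderiv ℝ f x))) ^ (1 / 2 : ℝ)) := by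
  obtain ⟨c, hc⟩ := hMZ
  refine ⟨c, fun f hf M e₀ r₁ hM he₀ hr₁ hE hMor => ?_⟩
  have hf1 : ContDiff ℝ 1 f := hf.of_le (by exact_mod_cast le_top)
  have hfm : Measurable f := hf.continuous.measurable
  have hK := ballGrowth_of_morrey hfm hM he₀ hr₁ hE hMor
  set w : (EuclideanSpace ℝ (Fin 3)) → ℝ := fun y => ‖f y‖ ^ 2 with hw
  have hwc : ContDiff ℝ (⊤ : ℕ∞) w := hf.norm_sq ℝ
  have hw_enorm : ∀ y, ‖w y‖ₑ = ‖f y‖ₑ ^ 2 := fun y => by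
    rw [hw]
    simp only
    rw [Real.enorm_of_nonneg (sq_nonneg _), ENNReal.ofReal_pow (norm_nonneg _), ofReal_norm]
  have hwi : Integrable w volume := by
    refine ⟨hwc.continuous.aestronglyMeasurable, ?_⟩
    show ∫⁻ y, ‖w y‖ₑ < ⊤
    calc ∫⁻ y, ‖w y‖ₑ = ∫⁻ y, ‖f y‖ₑ ^ 2 := lintegral_congr fun y => hw_enorm y
      _ ≤ ENNReal.ofReal e₀ := hE
      _ < ⊤ := ENNReal.ofReal_lt_top
  have h1 := hc (fun y => ‖f y‖ₑ) hfm.enorm _ hK w hwc hwi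
  calc ∫⁻ y, ‖f y‖ₑ ^ (3 : ℕ) = ∫⁻ y, ‖f y‖ₑ * ‖w y‖ₑ := by
        refine lintegral_congr fun y => ?_
        rw [hw_enorm, pow_succ', ]
    _ ≤ (c : ℝ≥0∞) * growthConst M e₀ r₁ * ∫⁻ x, ‖fderiv ℝ w x‖ₑ := h1
    _ ≤ (c : ℝ≥0∞) * growthConst M e₀ r₁ * (2 * (∫⁻ x, ‖f x‖ₑ ^ 2) ^ (1 / 2 : ℝ) *
          (∫⁻ x, ENNReal.ofReal (frobeniusNormSq (fderiv ℝ f x))) ^ (1 / 2 : ℝ)) :=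
        mul_le_mul_of_nonneg_left (lintegral_enorm_fderiv_norm_sq_le hf1) bot_le
    _ ≤ _ := by
        gcongr _ * (2 * ?_ * _)
        exact ENNReal.rpow_le_rpow hE (by norm_num)

/-! ### THEOREM J′ -/

/-- Velocity slices of a classical solution are measurable. -/
theorem measurable_velocity {ν T : ℝ} {u : ℝ → (EuclideanSpace ℝ (Fin 3)) → (EuclideanSpace ℝ (Fin 3))} {p : ℝ → (EuclideanSpace ℝ (Fin 3)) → ℝ}
    (hcl : IsClassicalNSSolutionOn (Ico 0 T) ν 0 u p) {t : ℝ} (ht : t ∈ Ico 0 T) :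
    Measurable (u t) :=
  (hcl.contDiff_velocity ht).continuous.measurable

/-- `‖f‖₃^q = (∫ ‖f‖ₑ³)^{q/3}`. -/
theorem eLpNorm_three_rpow_eq {α F : Type*} [MeasurableSpace α] [NormedAddCommGroup F]
    (μ : Measure α) (f : α → F) (q : ℝ) :
    eLpNorm f 3 μ ^ q = (∫⁻ x, ‖f x‖ₑ ^ (3 : ℕ) ∂μ) ^ (q / 3) := by
  have h3 : (3 : ℝ≥0∞) = ENNReal.ofReal 3 := by norm_num
  rw [h3, eLpNorm_eq_lintegral_rpow_enorm_toReal (by norm_num) ENNReal.ofReal_ne_top,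
    ENNReal.toReal_ofReal (by norm_num : (0:ℝ) ≤ 3), ← ENNReal.rpow_mul]
  congr 1
  · refine lintegral_congr fun x => ?_
    rw [show (3 : ℝ) = ((3 : ℕ) : ℝ) by norm_num, ENNReal.rpow_natCast]
  · ring

/-- finite dissipation on the slab (Tonelli + the Leray–Hopf energy inequality). -/
theorem dissip_lt_top {ν T : ℝ} {u : ℝ → (EuclideanSpace ℝ (Fin 3)) → (EuclideanSpace ℝ (Fin 3))} {p : ℝ → (EuclideanSpace ℝ (Fin 3)) → ℝ}
    (hcl : IsClassicalNSSolutionOn (Ico 0 T) ν 0 u p) (hLH : IsLerayHopfOn T ν 0 (u 0) u) :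
    ∫⁻ t in Ioo 0 T, dissipRate u t < ⊤ := by
  set g : ℝ × (EuclideanSpace ℝ (Fin 3)) → ℝ≥0∞ := fun z => ENNReal.ofReal (frobeniusNormSq (fderiv ℝ (u z.1) z.2)) with hg
  have hcont : ContinuousOn g (Ioo 0 T ×ˢ (univ : Set (EuclideanSpace ℝ (Fin 3)))) := by
    have h1 : ContinuousOn (fun z : ℝ × (EuclideanSpace ℝ (Fin 3)) => fderiv ℝ (u z.1) z.2) (Ioo 0 T ×ˢ (univ : Set (EuclideanSpace ℝ (Fin 3)))) :=
      (hcl.smooth_velocity.continuousOn_fderiv_slice (uniqueDiffOn_Ico 0 T)).mono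
        (prod_mono Ioo_subset_Ico_self Subset.rfl)
    exact (ENNReal.continuous_ofReal.comp continuous_frobeniusNormSq').comp_continuousOn h1
  have hprod : ((volume : Measure ℝ).restrict (Ioo 0 T)).prod (volume : Measure (EuclideanSpace ℝ (Fin 3))) =
      (volume : Measure (ℝ × (EuclideanSpace ℝ (Fin 3)))).restrict (Ioo 0 T ×ˢ univ) := by
    rw [Measure.restrict_prod_eq_prod_univ, ← Measure.volume_eq_prod]
  have hgm : AEMeasurable (uncurry fun t x => g (t, x))
      (((volume : Measure ℝ).restrict (Ioo 0 T)).prod (volume : Measure (EuclideanSpace ℝ (Fin 3)))) := by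
    rw [hprod]
    exact hcont.aemeasurable (measurableSet_Ioo.prod MeasurableSet.univ)
  have htonelli : ∫⁻ t in Ioo 0 T, dissipRate u t = ∫⁻ z in Ioo 0 T ×ˢ (univ : Set (EuclideanSpace ℝ (Fin 3))), g z := by
    change ∫⁻ t in Ioo 0 T, ∫⁻ x, g (t, x) = _
    rw [lintegral_lintegral hgm, hprod]
  rw [htonelli]
  exact SereginSverak2002.lintegral_slab_frobeniusNormSq_fderiv_lt_top' hcl hLH

/-- **J′, sixth-power form**: on the full-Morrey class, `t ↦ ‖u(t)‖₃⁶` is integrable up to `T`,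
with the slice inequality `(∫|u(t)|³)² ≤ A · ∫|∇u(t)|²` for all late `t`. -/
theorem lintegral_six_lt_top (hMZ : MazyaTraceW11) {ν T : ℝ} (hν : 0 < ν) (hT : 0 < T)
    {u : ℝ → (EuclideanSpace ℝ (Fin 3)) → (EuclideanSpace ℝ (Fin 3))} {p : ℝ → (EuclideanSpace ℝ (Fin 3)) → ℝ} (hcl : IsClassicalNSSolutionOn (Ico 0 T) ν 0 u p)
    (hLH : IsLerayHopfOn T ν 0 (u 0) u) (hFM : FullMorreyTypeINear u T) :
    ∃ T₂ ∈ Ioo 0 T, ∃ A : ℝ≥0∞, A ≠ ⊤ ∧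
      (∀ t ∈ Ioo T₂ T, (∫⁻ y, ‖u t y‖ₑ ^ (3 : ℕ)) ^ 2 ≤ A * dissipRate u t) ∧
      (∫⁻ t in Ioo T₂ T, eLpNorm (u t) 3 volume ^ (6 : ℝ)) < ⊤ := by
  obtain ⟨c, hc⟩ := lintegral_cube_le hMZ
  obtain ⟨M, hM, r₁, hr₁, T₁, hT₁, hMor⟩ := hFM
  set e₀ : ℝ := 2 * VectorCalculus.kineticEnergy (u 0) with he₀
  have he₀nn : 0 ≤ e₀ := mul_nonneg zero_le_two (kineticEnergy_nonneg _)
  set T₂ : ℝ := max T₁ (T / 2) with hT₂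
  have hT₂mem : T₂ ∈ Ioo 0 T := ⟨lt_max_of_lt_right (by linarith), max_lt hT₁ (by linarith)⟩
  set K : ℝ≥0 := growthConst M e₀ r₁ with hK
  set A : ℝ≥0∞ := ((c : ℝ≥0∞) * K * (2 * (ENNReal.ofReal e₀) ^ (1 / 2 : ℝ))) ^ 2 with hA
  have hAtop : A ≠ ⊤ := by
    refine ENNReal.pow_ne_top (ENNReal.mul_ne_top (ENNReal.mul_ne_top ENNReal.coe_ne_top
      ENNReal.coe_ne_top) (ENNReal.mul_ne_top (by norm_num) ?_))
    exact ENNReal.rpow_ne_top_of_nonneg (by norm_num) ENNReal.ofReal_ne_top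
  have hslice : ∀ t ∈ Ioo T₂ T, (∫⁻ y, ‖u t y‖ₑ ^ (3 : ℕ)) ^ 2 ≤ A * dissipRate u t := by
    intro t ht
    have htT₁ : T₁ < t := lt_of_le_of_lt (le_max_left _ _) ht.1
    have ht0 : 0 < t := hT₂mem.1.trans ht.1
    have htc : t ∈ Ico 0 T := ⟨ht0.le, ht.2⟩
    have hE : ∫⁻ y, ‖u t y‖ₑ ^ 2 ≤ ENNReal.ofReal e₀ := hLH.lintegral_enorm_sq_le hν.le ⟨ht0.le, ht.2.le⟩
    have h1 := hc (u t) (hcl.contDiff_velocity htc) M e₀ r₁ hM he₀nn hr₁ hE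
      (fun x₀ r hr hrr => hMor t ⟨htT₁, ht.2⟩ x₀ r hr hrr)
    calc (∫⁻ y, ‖u t y‖ₑ ^ (3 : ℕ)) ^ 2
        ≤ ((c : ℝ≥0∞) * K * (2 * (ENNReal.ofReal e₀) ^ (1 / 2 : ℝ) *
            (dissipRate u t) ^ (1 / 2 : ℝ))) ^ 2 := pow_le_pow_left' h1 2
      _ = A * dissipRate u t := by
          rw [hA, show (c : ℝ≥0∞) * K * (2 * (ENNReal.ofReal e₀) ^ (1 / 2 : ℝ) *
            (dissipRate u t) ^ (1 / 2 : ℝ)) = ((c : ℝ≥0∞) * K * (2 * (ENNReal.ofReal e₀) ^ (1 / 2 : ℝ)))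
              * (dissipRate u t) ^ (1 / 2 : ℝ) by ring, mul_pow]
          congr 1
          rw [← ENNReal.rpow_two, ← ENNReal.rpow_mul]
          norm_num
  refine ⟨T₂, hT₂mem, A, hAtop, hslice, ?_⟩
  -- integrate: `∫ ‖u‖₃⁶ = ∫ (∫|u|³)² ≤ A ∫ δ < ∞`
  have hdiss : ∫⁻ t in Ioo 0 T, dissipRate u t < ⊤ := dissip_lt_top hcl hLH
  calc ∫⁻ t in Ioo T₂ T, eLpNorm (u t) 3 volume ^ (6 : ℝ)
      = ∫⁻ t in Ioo T₂ T, (∫⁻ y, ‖u t y‖ₑ ^ (3 : ℕ)) ^ 2 := by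
        refine setLIntegral_congr_fun measurableSet_Ioo fun t ht => ?_
        rw [eLpNorm_three_rpow_eq, show (6 : ℝ) / 3 = 2 by norm_num, ENNReal.rpow_two]
    _ ≤ ∫⁻ t in Ioo T₂ T, A * dissipRate u t := setLIntegral_mono' measurableSet_Ioo hslice
    _ = A * ∫⁻ t in Ioo T₂ T, dissipRate u t := lintegral_const_mul' _ _ hAtop
    _ ≤ A * ∫⁻ t in Ioo 0 T, dissipRate u t :=
        mul_le_mul_of_nonneg_left (lintegral_mono_set (Ioo_subset_Ioo_left hT₂mem.1.le)) bot_le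
    _ < ⊤ := ENNReal.mul_lt_top hAtop.lt_top hdiss

/-- **THEOREM J′** (from the `W^{1,1}` trace inequality): all `q ≤ 6`. -/
theorem jawUpToSix_of (hMZ : MazyaTraceW11) : JawUpToSixOnFullMorrey := by
  intro ν T hν hT u p hcl hLH hFM q hq0 hq6
  obtain ⟨T₂, hT₂, A, -, -, h6⟩ := lintegral_six_lt_top hMZ hν hT hcl hLH hFM
  refine ⟨T₂, hT₂, ?_⟩
  have hpt : ∀ t ∈ Ioo T₂ T, eLpNorm (u t) 3 volume ^ q ≤ eLpNorm (u t) 3 volume ^ (6 : ℝ) + 1 := by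
    intro t _
    by_cases h1 : 1 ≤ eLpNorm (u t) 3 volume
    · exact (ENNReal.rpow_le_rpow_of_exponent_le h1 hq6).trans le_self_add
    · exact (ENNReal.rpow_le_one (le_of_not_ge h1) hq0).trans le_add_self
  calc ∫⁻ t in Ioo T₂ T, eLpNorm (u t) 3 volume ^ q
      ≤ ∫⁻ t in Ioo T₂ T, (eLpNorm (u t) 3 volume ^ (6 : ℝ) + 1) := setLIntegral_mono' measurableSet_Ioo hpt
    _ = (∫⁻ t in Ioo T₂ T, eLpNorm (u t) 3 volume ^ (6 : ℝ)) + ∫⁻ t in Ioo T₂ T, (1 : ℝ≥0∞) :=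
        lintegral_add_right' _ aemeasurable_const
    _ < ⊤ := by
        refine ENNReal.add_lt_top.2 ⟨h6, ?_⟩
        rw [setLIntegral_const, Real.volume_Ioo]
        exact ENNReal.mul_lt_top ENNReal.one_lt_top ENNReal.ofReal_lt_top

/-- **THEOREM J′ from Maz'ya's trace inequality for test functions** (§1.4.2 Thm 2). -/
theorem jawUpToSix_of_mazya (h : MazyaTraceD) : JawUpToSixOnFullMorrey :=
  jawUpToSix_of (mazyaTraceW11_of_D h)

/-- **The parent crux on the full-Morrey class**: the clause of `L3CascadeJaw` (every `q ∈ (4,5)`)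
for every frame solution that is full-Morrey-Type-I near `T` (decay hypothesis carried, unused). -/
theorem l3CascadeJaw_clause_on_fullMorrey (hJ : JawUpToSixOnFullMorrey) :
    ∀ q : ℝ, 4 < q → q < 5 → ∀ (ν T : ℝ), 0 < ν → 0 < T → ∀ (u : ℝ → (EuclideanSpace ℝ (Fin 3)) → (EuclideanSpace ℝ (Fin 3))) (p : ℝ → (EuclideanSpace ℝ (Fin 3)) → ℝ),
      IsClassicalNSSolutionOn (Ico 0 T) ν 0 u p → IsLerayHopfOn T ν 0 (u 0) u →
      HasRapidSpatialDecay (u 0) → FullMorreyTypeINear u T →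
        ∃ T₂ ∈ Ioo 0 T, (∫⁻ t in Ioo T₂ T, eLpNorm (u t) 3 volume ^ q) < ⊤ :=
  fun q hq4 hq5 ν T hν hT u p hcl hLH _ hFM => hJ ν T hν hT u p hcl hLH hFM q (by linarith) (by linarith)

/-! ### Hierarchy: time-Type-I ⟹ full Morrey ⟹ Morrey on cylinders reaching `T` -/

/-- Full Morrey-Type-I near `T` implies the Morrey bound on cylinders reaching `T` (`MorreyTypeINear` of the pace dichotomy). -/
theorem morreyTypeINear_of_full {u : ℝ → (EuclideanSpace ℝ (Fin 3)) → (EuclideanSpace ℝ (Fin 3))} {T : ℝ} (h : FullMorreyTypeINear u T) :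
    MorreyTypeINear u T := by
  obtain ⟨M, hM, r₁, hr₁, T₁, hT₁, hb⟩ := h
  have hgap : 0 < T - T₁ := sub_pos.2 hT₁
  refine ⟨M, hM, min r₁ (Real.sqrt (T - T₁)), lt_min hr₁ (Real.sqrt_pos.2 hgap), ?_⟩
  intro x₀ r hr hrlt t ht1 ht2
  have hr₁' : r < r₁ := lt_of_lt_of_le hrlt (min_le_left _ _)
  have hrs : r < Real.sqrt (T - T₁) := lt_of_lt_of_le hrlt (min_le_right _ _)
  have hr2 : r ^ 2 < T - T₁ := by
    have h1 : r ^ 2 < Real.sqrt (T - T₁) ^ 2 := pow_lt_pow_left₀ hrs hr.le (by norm_num)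
    rwa [Real.sq_sqrt hgap.le] at h1
  exact hb t ⟨by linarith, ht2⟩ x₀ r hr hr₁'

/-- time-Type-I (`|u(x,t)| ≤ C/√(T-t)` eventually) ⟹ full Morrey-Type-I (tree: the certificate-ladder
support item `scaledEnergyBound_proof`, Barker–Prange (e.typeI)). -/
theorem fullMorreyTypeINear_of_typeI {ν T : ℝ} (hν : 0 < ν) (hT : 0 < T)
    {u : ℝ → (EuclideanSpace ℝ (Fin 3)) → (EuclideanSpace ℝ (Fin 3))} {p : ℝ → (EuclideanSpace ℝ (Fin 3)) → ℝ}
    (hcl : IsClassicalNSSolutionOn (Ico 0 T) ν 0 u p) (hLH : IsLerayHopfOn T ν 0 (u 0) u)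
    (hdec : HasRapidSpatialDecay (u 0)) (hTI : IsTypeIBlowup u T) : FullMorreyTypeINear u T := by
  obtain ⟨C, hC⟩ := hTI
  have hsν : 0 < Real.sqrt ν := Real.sqrt_pos.2 hν
  set C' : ℝ := (|C| + 1) / Real.sqrt ν with hC'
  have hC'pos : 0 < C' := by positivity
  have hrate : ∀ᶠ t in 𝓝[<] T, ∀ x, Real.sqrt (T - t) * ‖u t x‖ ≤ C' * Real.sqrt ν := by
    have hlt : ∀ᶠ t in 𝓝[<] T, t < T := eventually_nhdsWithin_of_forall fun t ht => ht
    filter_upwards [hC, hlt] with t ht htT x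
    have hs : 0 < Real.sqrt (T - t) := Real.sqrt_pos.2 (sub_pos.2 htT)
    calc Real.sqrt (T - t) * ‖u t x‖ ≤ Real.sqrt (T - t) * (C / Real.sqrt (T - t)) :=
          mul_le_mul_of_nonneg_left (ht x) hs.le
      _ = C := by field_simp
      _ ≤ |C| + 1 := by linarith [le_abs_self C]
      _ = C' * Real.sqrt ν := by rw [hC']; field_simp
  obtain ⟨A, hA⟩ := scaledEnergyBound_proof C' hC'pos
  obtain ⟨r₀, hr₀, hmor⟩ := hA ν T hν hT u p hcl hLH hdec hrate
  obtain ⟨l, hlT, hl⟩ := mem_nhdsLT_iff_exists_Ioo_subset.1 hmor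
  set M : ℝ := max (A * ν ^ 2) 0 + 1 with hM
  have hMpos : 0 < M := by rw [hM]; positivity
  have hAM : A * ν ^ 2 ≤ M := by rw [hM]; linarith [le_max_left (A * ν ^ 2) 0]
  refine ⟨M, hMpos, r₀, hr₀, max l 0, max_lt hlT hT, fun t ht x₀ r hr hrr₀ => ?_⟩
  have htl : t ∈ Ioo l T := ⟨lt_of_le_of_lt (le_max_left _ _) ht.1, ht.2⟩
  have ht0 : 0 ≤ t := (lt_of_le_of_lt (le_max_right _ _) ht.1).le
  have hball := hl htl x₀ r hr hrr₀.le
  rw [inv_mul_le_iff₀ hr] at hball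
  have hcont : Continuous (u t) := (hcl.contDiff_velocity ⟨ht0, ht.2⟩).continuous
  rw [typeIConc_lintegral_ball_enorm_pow_eq hcont x₀ r 2]
  refine ENNReal.ofReal_le_ofReal ?_
  calc ∫ x in ball x₀ r, ‖u t x‖ ^ 2 ≤ r * (A * ν ^ 2) := hball
    _ ≤ r * M := mul_le_mul_of_nonneg_left hAM hr.le
    _ = M * r := mul_comm _ _

/-- Corollary: every time-Type-I frame blow-up is in `L^q_t L³_x` up to `T` for all `q ≤ 6`
(from the trace inequality; for time-Type-I this is also elementary by `‖u‖₃³ ≤ ‖u‖_∞ ‖u‖₂²`). -/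
theorem jaw_on_typeI (hJ : JawUpToSixOnFullMorrey) {ν T : ℝ} (hν : 0 < ν) (hT : 0 < T)
    {u : ℝ → (EuclideanSpace ℝ (Fin 3)) → (EuclideanSpace ℝ (Fin 3))} {p : ℝ → (EuclideanSpace ℝ (Fin 3)) → ℝ}
    (hcl : IsClassicalNSSolutionOn (Ico 0 T) ν 0 u p) (hLH : IsLerayHopfOn T ν 0 (u 0) u)
    (hdec : HasRapidSpatialDecay (u 0)) (hTI : IsTypeIBlowup u T) {q : ℝ} (hq0 : 0 ≤ q) (hq6 : q ≤ 6) :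
    ∃ T₂ ∈ Ioo 0 T, (∫⁻ t in Ioo T₂ T, eLpNorm (u t) 3 volume ^ q) < ⊤ :=
  hJ ν T hν hT u p hcl hLH (fullMorreyTypeINear_of_typeI hν hT hcl hLH hdec hTI) q hq0 hq6

/-! ### The rungs BY NAME: `NoTypeII → AllBlowupsFullMorreyB` and `MazyaTraceD → AllBlowupsFullMorreyB → L3CascadeJaw` -/

/-- **Every frame blow-up is full-Morrey-Type-I near its blow-up time** (scaled-energy Type I on ALL late
cylinders).  OPEN; implied by `NoTypeII` (hard core `stmt-NavierStokesRegularity-0056`) through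
`fullMorreyTypeINear_of_typeI`, not conversely (a full-Morrey blow-up may have Type-II sup-rate). -/
@[conjecture] def AllBlowupsFullMorreyB : Prop :=
  ∀ (ν T : ℝ), 0 < ν → 0 < T →
    ∀ (u : ℝ → (EuclideanSpace ℝ (Fin 3)) → (EuclideanSpace ℝ (Fin 3))) (p : ℝ → (EuclideanSpace ℝ (Fin 3)) → ℝ),
    IsClassicalNSSolutionOn (Ico 0 T) ν 0 u p → IsLerayHopfOn T ν 0 (u 0) u →
    HasRapidSpatialDecay (u 0) → ¬ HasSmoothExtensionPast ν 0 u T → FullMorreyTypeINear u T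

/-- hard core 0056 ⇒ the full-Morrey hypothesis (through the certificate ladder's `scaledEnergyBound_proof`). -/
theorem allBlowupsFullMorreyB_of_noTypeII
    (h : Summit.NavierStokesRegularity.NavierStokesRegularity.Theses.TypeICertificateLadder.NoTypeII) :
    AllBlowupsFullMorreyB :=
  fun ν T hν hT u p hcl hLH hdec hmax =>
    fullMorreyTypeINear_of_typeI hν hT hcl hLH hdec (h ν T hν hT u p ⟨hcl, hmax⟩ hLH hdec)

/-- **The parent crux BY NAME**: Maz'ya's trace inequality + "all blow-ups are full-Morrey-Type-I" ⇒
`L3CascadeJaw` (`stmt-NavierStokesRegularity-19499`); the smooth branch is the landed `jawSmoothBranch_holds`. -/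
theorem l3CascadeJaw_of_allBlowupsFullMorrey (hMZ : MazyaTraceD) (hA : AllBlowupsFullMorreyB) :
    Summit.NavierStokesRegularity.NavierStokesRegularity.Theses.L3TimeExponentPincer.L3CascadeJaw := by
  intro q hq4 hq5 ν T hν hT u p hcl hLH hdec
  by_cases hext : HasSmoothExtensionPast ν 0 u T
  · exact Summit.NavierStokesRegularity.NavierStokesRegularity.Theorems.L3TimeExponentPincerSmoothBranch.jawSmoothBranch_holds
      q hq4 hq5 ν T hν hT u p hcl hLH hdec hext
  · exact l3CascadeJaw_clause_on_fullMorrey (jawUpToSix_of_mazya hMZ) q hq4 hq5 ν T hν hT u p hcl hLH hdec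
      (hA ν T hν hT u p hcl hLH hdec hext)


end Summit.NavierStokesRegularity.NavierStokesRegularity.Theorems.L3TimeExponentPincerJawFullMorrey

end
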